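import Mathlib
import Summits.Parity.BatemanHorn.Theorems.IsogenyRedeiSplitBlockJacobiAbel
import HarnessLib

/-!
# The separated weight `G_h` and its variation on a cell (helper toward `stub_poissonReduction`,
line `cofactor-root-discrepancy`, crux `SplitBlockJacobi`, stmt-Parity-11583)

For `G_h(q) = (1/q) Σ_{t ≤ x} w(t) e(ht/q)` (`w ≥ 0`, `W₁ = Σ w`): the bridge to
`ψ_c(q) = e(c/q)/q` (`G_eq_sum_psi`), the bounds `|G_h(q)| ≤ W₁/q`, first differences in each
variable and the mixed second difference inside a cell with corner `(a, b)`, and the variation bound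
`V(G_h) ≤ 4 W₁ (1 + 3π|h|x/(ab))²/(ab)` on `(a, a'] × (b, b']`, `a' ≤ 2a`, `b' ≤ 2b`
(`variation_G_le`), which is what two-dimensional Abel summation consumes.
-/

noncomputable section

open Finset

namespace Summit.Parity.BatemanHorn.Cruxes.SplitBlockJacobi.CofactorRootDiscrepancy.Poisson

/-! ### The separated weight `G_h(q) = (1/q) Σ_t w(t) e(ht/q)` and its variation on a cell -/

/-- The weight `G_h(q) = (1/q) Σ_{1 ≤ t ≤ x} w(t) e(ht/q)` (local notation; `q : ℕ`). -/
local notation3 (prettyPrint := false) "Gw[" w ", " x ", " h "](" q ")" =>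
  ((1 / ((q : ℕ) : ℂ)) * ∑ t ∈ Finset.Icc 1 x, ((w t : ℝ) : ℂ) *
    Complex.exp (2 * Real.pi * Complex.I * ((h : ℤ) : ℂ) * ((t : ℕ) : ℂ) / ((q : ℕ) : ℂ)))

/-- Bridge: `G_h(q) = Σ_t w(t) ψ_{ht}(q)` with `ψ_c(q) = e(c/q)/q` in the real-parameter form. -/
theorem G_eq_sum_psi (w : ℕ → ℝ) (x : ℕ) (h : ℤ) (q : ℕ) (hq : 0 < q) :
    Gw[w, x, h](q) = ∑ t ∈ Finset.Icc 1 x, ((w t : ℝ) : ℂ) *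
      (Complex.exp (2 * Real.pi * Complex.I * (((h : ℝ) * t / (q : ℝ) : ℝ) : ℂ)) / ((q : ℝ) : ℂ)) := by
  rw [Finset.mul_sum]
  refine Finset.sum_congr rfl fun t _ => ?_
  have hqC : (q : ℂ) ≠ 0 := by exact_mod_cast hq.ne'
  have harg : Complex.exp (2 * Real.pi * Complex.I * ((h : ℤ) : ℂ) * ((t : ℕ) : ℂ) / ((q : ℕ) : ℂ)) =
      Complex.exp (2 * Real.pi * Complex.I * (((h : ℝ) * t / (q : ℝ) : ℝ) : ℂ)) := by
    congr 1
    push_cast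
    field_simp
  rw [harg]
  push_cast
  ring

/-- `|G_h(q)| ≤ W₁/q`, `W₁ = Σ_t w(t)` (`w ≥ 0`). -/
theorem norm_G_le (w : ℕ → ℝ) (hw : ∀ t, 0 ≤ w t) (x : ℕ) (h : ℤ) (q : ℕ) (hq : 0 < q) :
    ‖Gw[w, x, h](q)‖ ≤ (∑ t ∈ Finset.Icc 1 x, w t) / q := by
  rw [G_eq_sum_psi w x h q hq, Finset.sum_div]
  refine (norm_sum_le _ _).trans (Finset.sum_le_sum fun t _ => ?_)
  rw [norm_mul, Complex.norm_real, Real.norm_eq_abs, abs_of_nonneg (hw t), norm_div,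
    norm_exp_two_pi_mul_I, Complex.norm_real, Real.norm_eq_abs, abs_of_pos (by exact_mod_cast hq),
    mul_one_div]

/-- Generic first-difference bound: for `0 < q ≤ q'` naturals,
`|G_h(q') − G_h(q)| ≤ W₁ · (q'−q)/(qq') · (1 + 2π|h|x/q)`. -/
theorem norm_G_sub_G_le (w : ℕ → ℝ) (hw : ∀ t, 0 ≤ w t) (x : ℕ) (h : ℤ) {q q' : ℕ} (hq : 0 < q)
    (hqq' : q ≤ q') :
    ‖Gw[w, x, h](q') - Gw[w, x, h](q)‖ ≤
      (∑ t ∈ Finset.Icc 1 x, w t) * (((q' : ℝ) - q) / ((q : ℝ) * q') *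
        (1 + 2 * Real.pi * (|(h : ℝ)| * x) / q)) := by
  have hq' : 0 < q' := lt_of_lt_of_le hq hqq'
  rw [G_eq_sum_psi w x h q hq, G_eq_sum_psi w x h q' hq', ← Finset.sum_sub_distrib, Finset.sum_mul]
  refine (norm_sum_le _ _).trans (Finset.sum_le_sum fun t ht => ?_)
  rw [← mul_sub, norm_mul, Complex.norm_real, Real.norm_eq_abs, abs_of_nonneg (hw t)]
  refine mul_le_mul_of_nonneg_left ?_ (hw t)
  have hb := norm_psi_sub_psi_le ((h : ℝ) * t) (by exact_mod_cast hq : (0 : ℝ) < q)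
    (by exact_mod_cast hqq' : (q : ℝ) ≤ q')
  refine hb.trans ?_
  have htx : (t : ℝ) ≤ x := by exact_mod_cast (Finset.mem_Icc.mp ht).2
  have hdq : 0 ≤ ((q' : ℝ) - q) / ((q : ℝ) * q') :=
    div_nonneg (sub_nonneg.mpr (by exact_mod_cast hqq')) (by positivity)
  refine mul_le_mul_of_nonneg_left ?_ hdq
  rw [abs_mul, Nat.abs_cast]
  have : 2 * Real.pi * (|(h : ℝ)| * t) / q ≤ 2 * Real.pi * (|(h : ℝ)| * x) / q := by
    refine div_le_div_of_nonneg_right ?_ (by positivity)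
    exact mul_le_mul_of_nonneg_left (mul_le_mul_of_nonneg_left htx (abs_nonneg _)) (by positivity)
  linarith

/-- `|G_h(a'b')| ≤ W₁/(ab)` for `a ≤ a'`, `b ≤ b'` (`a, b ≥ 1`). -/
theorem norm_G_corner_le (w : ℕ → ℝ) (hw : ∀ t, 0 ≤ w t) (x : ℕ) (h : ℤ) {a b a' b' : ℕ}
    (ha : 1 ≤ a) (hb : 1 ≤ b) (haa' : a ≤ a') (hbb' : b ≤ b') :
    ‖Gw[w, x, h](a' * b')‖ ≤ (∑ t ∈ Finset.Icc 1 x, w t) / ((a : ℝ) * b) := by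
  have hW : 0 ≤ ∑ t ∈ Finset.Icc 1 x, w t := Finset.sum_nonneg fun t _ => hw t
  refine (norm_G_le w hw x h (a' * b') (Nat.mul_pos (by omega) (by omega))).trans ?_
  push_cast
  exact div_le_div_of_nonneg_left hW (by positivity)
    (mul_le_mul (by exact_mod_cast haa') (by exact_mod_cast hbb') (by positivity) (by positivity))

/-- First difference in `m` inside a cell with lower-left corner `(a, b)`:
`|G_h((m+1)n) − G_h(mn)| ≤ W₁ (1 + 2π|h|x/(ab)) / (a·ab)` for `a ≤ m`, `b ≤ n`. -/
theorem norm_G_diff_fst_le (w : ℕ → ℝ) (hw : ∀ t, 0 ≤ w t) (x : ℕ) (h : ℤ) {a b m n : ℕ}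
    (ha : 1 ≤ a) (hb : 1 ≤ b) (ham : a ≤ m) (hbn : b ≤ n) :
    ‖Gw[w, x, h]((m + 1) * n) - Gw[w, x, h](m * n)‖ ≤
      (∑ t ∈ Finset.Icc 1 x, w t) * ((1 + 2 * Real.pi * (|(h : ℝ)| * x) / ((a : ℝ) * b)) /
        ((a : ℝ) * ((a : ℝ) * b))) := by
  have hm : 0 < m := by omega
  have hn : 0 < n := by omega
  refine (norm_G_sub_G_le w hw x h (Nat.mul_pos hm hn) (Nat.mul_le_mul_right n (Nat.le_succ m))).trans ?_
  have hW : 0 ≤ ∑ t ∈ Finset.Icc 1 x, w t := Finset.sum_nonneg fun t _ => hw t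
  refine mul_le_mul_of_nonneg_left ?_ hW
  have hmR : (0 : ℝ) < m := by exact_mod_cast hm
  have hnR : (0 : ℝ) < n := by exact_mod_cast hn
  have haR : (a : ℝ) ≤ m := by exact_mod_cast ham
  have hbR : (b : ℝ) ≤ n := by exact_mod_cast hbn
  have e1 : (((m + 1) * n : ℕ) : ℝ) - ((m * n : ℕ) : ℝ) = n := by push_cast; ring
  have e2 : ((((m + 1) * n : ℕ) : ℝ) - ((m * n : ℕ) : ℝ)) / (((m * n : ℕ) : ℝ) * (((m + 1) * n : ℕ) : ℝ)) =
      1 / ((m : ℝ) * (m + 1) * n) := by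
    rw [e1]; push_cast; field_simp
  rw [e2, div_eq_mul_one_div (1 + _) ((a : ℝ) * _), mul_comm (1 / ((m : ℝ) * (m + 1) * n))]
  have hb0 : (0 : ℝ) < b := by exact_mod_cast (show 0 < b by omega)
  have h1 : (a : ℝ) * b ≤ m * n := mul_le_mul haR hbR hb0.le hmR.le
  have h2 : (a : ℝ) * ((a : ℝ) * b) ≤ m * (m * n) := mul_le_mul haR h1 (by positivity) hmR.le
  refine mul_le_mul ?_ ?_ (by positivity) (by positivity)
  · refine add_le_add le_rfl (div_le_div_of_nonneg_left (by positivity) (by positivity) ?_)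
    push_cast; exact h1
  · exact div_le_div_of_nonneg_left zero_le_one (by positivity)
      (by nlinarith [mul_pos hmR hnR])

/-- First difference in `n` inside a cell with lower-left corner `(a, b)`:
`|G_h(m(n+1)) − G_h(mn)| ≤ W₁ (1 + 2π|h|x/(ab)) / (b·ab)` for `a ≤ m`, `b ≤ n`. -/
theorem norm_G_diff_snd_le (w : ℕ → ℝ) (hw : ∀ t, 0 ≤ w t) (x : ℕ) (h : ℤ) {a b m n : ℕ}
    (ha : 1 ≤ a) (hb : 1 ≤ b) (ham : a ≤ m) (hbn : b ≤ n) :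
    ‖Gw[w, x, h](m * (n + 1)) - Gw[w, x, h](m * n)‖ ≤
      (∑ t ∈ Finset.Icc 1 x, w t) * ((1 + 2 * Real.pi * (|(h : ℝ)| * x) / ((a : ℝ) * b)) /
        ((b : ℝ) * ((a : ℝ) * b))) := by
  have hm : 0 < m := by omega
  have hn : 0 < n := by omega
  refine (norm_G_sub_G_le w hw x h (Nat.mul_pos hm hn) (Nat.mul_le_mul_left m (Nat.le_succ n))).trans ?_
  have hW : 0 ≤ ∑ t ∈ Finset.Icc 1 x, w t := Finset.sum_nonneg fun t _ => hw t
  refine mul_le_mul_of_nonneg_left ?_ hW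
  have hmR : (0 : ℝ) < m := by exact_mod_cast hm
  have hnR : (0 : ℝ) < n := by exact_mod_cast hn
  have haR : (a : ℝ) ≤ m := by exact_mod_cast ham
  have hbR : (b : ℝ) ≤ n := by exact_mod_cast hbn
  have e1 : ((m * (n + 1) : ℕ) : ℝ) - ((m * n : ℕ) : ℝ) = m := by push_cast; ring
  have e2 : (((m * (n + 1) : ℕ) : ℝ) - ((m * n : ℕ) : ℝ)) / (((m * n : ℕ) : ℝ) * ((m * (n + 1) : ℕ) : ℝ)) =
      1 / ((m : ℝ) * n * (n + 1)) := by
    rw [e1]; push_cast; field_simp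
  rw [e2, div_eq_mul_one_div (1 + _) ((b : ℝ) * _), mul_comm (1 / ((m : ℝ) * n * (n + 1)))]
  have hb0 : (0 : ℝ) < b := by exact_mod_cast (show 0 < b by omega)
  have h1 : (a : ℝ) * b ≤ m * n := mul_le_mul haR hbR hb0.le hmR.le
  have h2 : (b : ℝ) * ((a : ℝ) * b) ≤ n * (m * n) := mul_le_mul hbR h1 (by positivity) hnR.le
  refine mul_le_mul ?_ ?_ (by positivity) (by positivity)
  · refine add_le_add le_rfl (div_le_div_of_nonneg_left (by positivity) (by positivity) ?_)
    push_cast; exact h1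
  · exact div_le_div_of_nonneg_left zero_le_one (by positivity)
      (by nlinarith [mul_pos hmR hnR])

/-- Mixed second difference inside a cell with lower-left corner `(a, b)`:
`|G_h((m+1)(n+1)) − G_h((m+1)n) − G_h(m(n+1)) + G_h(mn)| ≤ W₁ (1 + 3π|h|x/(ab))² / (ab)²`. -/
theorem norm_G_diff_mixed_le (w : ℕ → ℝ) (hw : ∀ t, 0 ≤ w t) (x : ℕ) (h : ℤ) {a b m n : ℕ}
    (ha : 1 ≤ a) (hb : 1 ≤ b) (ham : a ≤ m) (hbn : b ≤ n) :
    ‖Gw[w, x, h]((m + 1) * (n + 1)) - Gw[w, x, h]((m + 1) * n) - Gw[w, x, h](m * (n + 1)) +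
        Gw[w, x, h](m * n)‖ ≤
      (∑ t ∈ Finset.Icc 1 x, w t) * ((1 + 3 * Real.pi * (|(h : ℝ)| * x) / ((a : ℝ) * b)) ^ 2 /
        ((a : ℝ) * b) ^ 2) := by
  have hm : 0 < m := by omega
  have hn : 0 < n := by omega
  rw [G_eq_sum_psi w x h ((m + 1) * (n + 1)) (by positivity),
    G_eq_sum_psi w x h ((m + 1) * n) (by positivity),
    G_eq_sum_psi w x h (m * (n + 1)) (by positivity),
    G_eq_sum_psi w x h (m * n) (by positivity), ← Finset.sum_sub_distrib, ← Finset.sum_sub_distrib,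
    ← Finset.sum_add_distrib, Finset.sum_mul]
  refine (norm_sum_le _ _).trans (Finset.sum_le_sum fun t ht => ?_)
  rw [← mul_sub, ← mul_sub, ← mul_add, norm_mul, Complex.norm_real, Real.norm_eq_abs,
    abs_of_nonneg (hw t)]
  refine mul_le_mul_of_nonneg_left ?_ (hw t)
  have hmR : (1 : ℝ) ≤ m := by exact_mod_cast hm
  have hnR : (1 : ℝ) ≤ n := by exact_mod_cast hn
  have hb0 := norm_mixed_diff_psi_le ((h : ℝ) * t) hmR hnR
  simp only [Nat.cast_mul, Nat.cast_add, Nat.cast_one]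
  refine hb0.trans ?_
  have htx : (t : ℝ) ≤ x := by exact_mod_cast (Finset.mem_Icc.mp ht).2
  have haR : (a : ℝ) ≤ m := by exact_mod_cast ham
  have hbR : (b : ℝ) ≤ n := by exact_mod_cast hbn
  have ha0 : (0 : ℝ) < a := by exact_mod_cast ha
  have hb0' : (0 : ℝ) < b := by exact_mod_cast hb
  have hab : (a : ℝ) * b ≤ m * n := mul_le_mul haR hbR hb0'.le (by linarith)
  have hnum : 1 + 3 * Real.pi * |(h : ℝ) * t| / ((m : ℝ) * n) ≤
      1 + 3 * Real.pi * (|(h : ℝ)| * x) / ((a : ℝ) * b) := by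
    have key : |(h : ℝ) * t| / ((m : ℝ) * n) ≤ (|(h : ℝ)| * x) / ((a : ℝ) * b) := by
      rw [abs_mul, Nat.abs_cast]
      exact div_le_div₀ (by positivity) (mul_le_mul_of_nonneg_left htx (abs_nonneg _))
        (by positivity) hab
    calc 1 + 3 * Real.pi * |(h : ℝ) * t| / ((m : ℝ) * n)
        = 1 + 3 * Real.pi * (|(h : ℝ) * t| / ((m : ℝ) * n)) := by ring
      _ ≤ 1 + 3 * Real.pi * ((|(h : ℝ)| * x) / ((a : ℝ) * b)) := by gcongr
      _ = _ := by ring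
  have hnum0 : 0 ≤ 1 + 3 * Real.pi * |(h : ℝ) * t| / ((m : ℝ) * n) := by positivity
  exact div_le_div₀ (by positivity) (pow_le_pow_left₀ hnum0 hnum 2) (by positivity)
    (pow_le_pow_left₀ (by positivity) hab 2)

/-- **Variation of `G_h` on a cell.** For `1 ≤ a ≤ a' ≤ 2a`, `1 ≤ b ≤ b' ≤ 2b`, the quantity
`V = |G(a'b')| + Σ_{a≤m<a'} |Δ₁G(m,b')| + Σ_{b≤n<b'} |Δ₂G(a',n)| + Σ_m Σ_n |Δ₁Δ₂G(m,n)|` of the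
two-dimensional Abel bound satisfies `V ≤ 4 W₁ (1 + 3π|h|x/(ab))² / (ab)`. -/
theorem variation_G_le (w : ℕ → ℝ) (hw : ∀ t, 0 ≤ w t) (x : ℕ) (h : ℤ) {a b a' b' : ℕ}
    (ha : 1 ≤ a) (hb : 1 ≤ b) (haa' : a ≤ a') (ha2 : a' ≤ 2 * a) (hbb' : b ≤ b') (hb2 : b' ≤ 2 * b) :
    ‖Gw[w, x, h](a' * b')‖ +
        ∑ m ∈ Finset.Ico a a', ‖Gw[w, x, h]((m + 1) * b') - Gw[w, x, h](m * b')‖ +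
        ∑ n ∈ Finset.Ico b b', ‖Gw[w, x, h](a' * (n + 1)) - Gw[w, x, h](a' * n)‖ +
        ∑ m ∈ Finset.Ico a a', ∑ n ∈ Finset.Ico b b',
          ‖Gw[w, x, h]((m + 1) * (n + 1)) - Gw[w, x, h]((m + 1) * n) - Gw[w, x, h](m * (n + 1)) +
            Gw[w, x, h](m * n)‖ ≤
      4 * (∑ t ∈ Finset.Icc 1 x, w t) * (1 + 3 * Real.pi * (|(h : ℝ)| * x) / ((a : ℝ) * b)) ^ 2 /
        ((a : ℝ) * b) := by
  set W₁ : ℝ := ∑ t ∈ Finset.Icc 1 x, w t with hW₁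
  set Y : ℝ := 1 + 3 * Real.pi * (|(h : ℝ)| * x) / ((a : ℝ) * b) with hY
  set Y' : ℝ := 1 + 2 * Real.pi * (|(h : ℝ)| * x) / ((a : ℝ) * b) with hY'
  have hW : 0 ≤ W₁ := Finset.sum_nonneg fun t _ => hw t
  have ha0 : (0 : ℝ) < a := by exact_mod_cast ha
  have hb0 : (0 : ℝ) < b := by exact_mod_cast hb
  have hY1 : 1 ≤ Y := by rw [hY]; exact le_add_of_nonneg_right (by positivity)
  have hY'Y : Y' ≤ Y := by
    rw [hY, hY']
    refine add_le_add le_rfl (div_le_div_of_nonneg_right ?_ (by positivity))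
    have : 0 ≤ Real.pi * (|(h : ℝ)| * x) := by positivity
    nlinarith [this]
  have hY'0 : 0 ≤ Y' := by positivity
  -- term by term
  have h1 : ‖Gw[w, x, h](a' * b')‖ ≤ W₁ / ((a : ℝ) * b) := norm_G_corner_le w hw x h ha hb haa' hbb'
  have h2 : ∑ m ∈ Finset.Ico a a', ‖Gw[w, x, h]((m + 1) * b') - Gw[w, x, h](m * b')‖ ≤
      W₁ * Y / ((a : ℝ) * b) := by
    calc ∑ m ∈ Finset.Ico a a', ‖Gw[w, x, h]((m + 1) * b') - Gw[w, x, h](m * b')‖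
        ≤ ∑ m ∈ Finset.Ico a a', W₁ * (Y' / ((a : ℝ) * ((a : ℝ) * b))) :=
          Finset.sum_le_sum fun m hm =>
            norm_G_diff_fst_le w hw x h ha hb (Finset.mem_Ico.mp hm).1 hbb'
      _ = ((a' : ℝ) - a) * (W₁ * (Y' / ((a : ℝ) * ((a : ℝ) * b)))) := by
          rw [Finset.sum_const, Nat.card_Ico, nsmul_eq_mul, Nat.cast_sub haa']
      _ ≤ (a : ℝ) * (W₁ * (Y / ((a : ℝ) * ((a : ℝ) * b)))) := by
          refine mul_le_mul ?_ ?_ (by positivity) (by positivity)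
          · have : (a' : ℝ) ≤ 2 * a := by exact_mod_cast ha2
            linarith
          · exact mul_le_mul_of_nonneg_left (div_le_div_of_nonneg_right hY'Y (by positivity)) hW
      _ = W₁ * Y / ((a : ℝ) * b) := by field_simp
  have h3 : ∑ n ∈ Finset.Ico b b', ‖Gw[w, x, h](a' * (n + 1)) - Gw[w, x, h](a' * n)‖ ≤
      W₁ * Y / ((a : ℝ) * b) := by
    calc ∑ n ∈ Finset.Ico b b', ‖Gw[w, x, h](a' * (n + 1)) - Gw[w, x, h](a' * n)‖
        ≤ ∑ n ∈ Finset.Ico b b', W₁ * (Y' / ((b : ℝ) * ((a : ℝ) * b))) :=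
          Finset.sum_le_sum fun n hn =>
            norm_G_diff_snd_le w hw x h ha hb haa' (Finset.mem_Ico.mp hn).1
      _ = ((b' : ℝ) - b) * (W₁ * (Y' / ((b : ℝ) * ((a : ℝ) * b)))) := by
          rw [Finset.sum_const, Nat.card_Ico, nsmul_eq_mul, Nat.cast_sub hbb']
      _ ≤ (b : ℝ) * (W₁ * (Y / ((b : ℝ) * ((a : ℝ) * b)))) := by
          refine mul_le_mul ?_ ?_ (by positivity) (by positivity)
          · have : (b' : ℝ) ≤ 2 * b := by exact_mod_cast hb2
            linarith
          · exact mul_le_mul_of_nonneg_left (div_le_div_of_nonneg_right hY'Y (by positivity)) hW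
      _ = W₁ * Y / ((a : ℝ) * b) := by field_simp
  have h4 : ∑ m ∈ Finset.Ico a a', ∑ n ∈ Finset.Ico b b',
      ‖Gw[w, x, h]((m + 1) * (n + 1)) - Gw[w, x, h]((m + 1) * n) - Gw[w, x, h](m * (n + 1)) +
        Gw[w, x, h](m * n)‖ ≤ W₁ * Y ^ 2 / ((a : ℝ) * b) := by
    calc ∑ m ∈ Finset.Ico a a', ∑ n ∈ Finset.Ico b b',
          ‖Gw[w, x, h]((m + 1) * (n + 1)) - Gw[w, x, h]((m + 1) * n) - Gw[w, x, h](m * (n + 1)) +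
            Gw[w, x, h](m * n)‖
        ≤ ∑ m ∈ Finset.Ico a a', ∑ n ∈ Finset.Ico b b', W₁ * (Y ^ 2 / ((a : ℝ) * b) ^ 2) :=
          Finset.sum_le_sum fun m hm => Finset.sum_le_sum fun n hn =>
            norm_G_diff_mixed_le w hw x h ha hb (Finset.mem_Ico.mp hm).1 (Finset.mem_Ico.mp hn).1
      _ = ((a' : ℝ) - a) * (((b' : ℝ) - b) * (W₁ * (Y ^ 2 / ((a : ℝ) * b) ^ 2))) := by
          rw [Finset.sum_const, Nat.card_Ico, nsmul_eq_mul, Nat.cast_sub haa', Finset.sum_const,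
            Nat.card_Ico, nsmul_eq_mul, Nat.cast_sub hbb']
      _ ≤ (a : ℝ) * ((b : ℝ) * (W₁ * (Y ^ 2 / ((a : ℝ) * b) ^ 2))) := by
          have ha' : (a' : ℝ) - a ≤ a := by
            have : (a' : ℝ) ≤ 2 * a := by exact_mod_cast ha2
            linarith
          have hb' : (b' : ℝ) - b ≤ b := by
            have : (b' : ℝ) ≤ 2 * b := by exact_mod_cast hb2
            linarith
          have ha'' : 0 ≤ (a' : ℝ) - a := sub_nonneg.mpr (by exact_mod_cast haa')
          have hb'' : 0 ≤ (b' : ℝ) - b := sub_nonneg.mpr (by exact_mod_cast hbb')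
          exact mul_le_mul ha' (mul_le_mul_of_nonneg_right hb' (by positivity)) (by positivity)
            (by positivity)
      _ = W₁ * Y ^ 2 / ((a : ℝ) * b) := by field_simp
  have hfin : W₁ / ((a : ℝ) * b) + W₁ * Y / ((a : ℝ) * b) + W₁ * Y / ((a : ℝ) * b) +
      W₁ * Y ^ 2 / ((a : ℝ) * b) ≤ 4 * W₁ * Y ^ 2 / ((a : ℝ) * b) := by
    rw [← add_div, ← add_div, ← add_div]
    refine div_le_div_of_nonneg_right ?_ (by positivity)
    nlinarith [mul_nonneg hW (sub_nonneg.mpr hY1), mul_nonneg (mul_nonneg hW (sub_nonneg.mpr hY1)) (by linarith : (0:ℝ) ≤ Y)]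
  linarith [h1, h2, h3, h4, hfin]

end Summit.Parity.BatemanHorn.Cruxes.SplitBlockJacobi.CofactorRootDiscrepancy.Poisson

namespace Summit.Parity.BatemanHorn.Cruxes.SplitBlockJacobi.CofactorRootDiscrepancy

/-- **Registered stub form** of `Poisson.variation_G_le`: the identical statement, declared in the crux
namespace under the name registered on stmt-Parity-11583 (`ledger workitem stub-add`). -/
theorem variation_G_le :
    ∀ (w : ℕ → ℝ) (hw : ∀ t, 0 ≤ w t) (x : ℕ) (h : ℤ) {a b a' b' : ℕ} (ha : 1 ≤ a) (hb : 1 ≤ b) (haa' : a ≤ a') (ha2 : a' ≤ 2 * a) (hbb' : b ≤ b') (hb2 : b' ≤ 2 * b), ‖((1 / ((a' * b' : ℕ) : ℂ)) * ∑ t ∈ Finset.Icc 1 x, ((w t : ℝ) : ℂ) * Complex.exp (2 * Real.pi * Complex.I * ((h : ℤ) : ℂ) * ((t : ℕ) : ℂ) / ((a' * b' : ℕ) : ℂ)))‖ + ∑ m ∈ Finset.Ico a a', ‖((1 / (((m + 1) * b' : ℕ) : ℂ)) * ∑ t ∈ Finset.Icc 1 x, ((w t : ℝ) : ℂ) * Complex.exp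 (2 * Real.pi * Complex.I * ((h : ℤ) : ℂ) * ((t : ℕ) : ℂ) / (((m + 1) * b' : ℕ) : ℂ))) - ((1 / ((m * b' : ℕ) : ℂ)) * ∑ t ∈ Finset.Icc 1 x, ((w t : ℝ) : ℂ) * Complex.exp (2 * Real.pi * Complex.I * ((h : ℤ) : ℂ) * ((t : ℕ) : ℂ) / ((m * b' : ℕ) : ℂ)))‖ + ∑ n ∈ Finset.Ico b b', ‖((1 / ((a' * (n + 1) : ℕ) : ℂ)) * ∑ t ∈ Finset.Icc 1 x, ((w t : ℝ) : ℂ) * Complex.exp (2 * Real.pi * Complex.I * ((h : ℤ) : ℂ) * ((t : ℕ) : ℂ) / ((a' * (n + 1) : ℕ) : ℂ))) - ((1 / ((a' * n : ℕ) : ℂ)) * ∑ t ∈ Finset.Icc 1 x, ((w t : ℝ) : ℂ) * Complex.exp (2 * Real.pi * Complex.I * ((h : ℤ) : ℂ) * ((t : ℕ) : ℂ) / ((a' * n : ℕ) : ℂ)))‖ + ∑ m ∈ Finset.Ico a a', ∑ n ∈ Finset.Ico b b', ‖((1 / (((m + 1) * (n + 1) : ℕ) : ℂ)) * ∑ t ∈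 Finset.Icc 1 x, ((w t : ℝ) : ℂ) * Complex.exp (2 * Real.pi * Complex.I * ((h : ℤ) : ℂ) * ((t : ℕ) : ℂ) / (((m + 1) * (n + 1) : ℕ) : ℂ))) - ((1 / (((m + 1) * n : ℕ) : ℂ)) * ∑ t ∈ Finset.Icc 1 x, ((w t : ℝ) : ℂ) * Complex.exp (2 * Real.pi * Complex.I * ((h : ℤ) : ℂ) * ((t : ℕ) : ℂ) / (((m + 1) * n : ℕ) : ℂ))) - ((1 / ((m * (n + 1) : ℕ) : ℂ)) * ∑ t ∈ Finset.Icc 1 x, ((w t : ℝ) : ℂ) * Complex.exp (2 * Real.pi * Complex.I * ((h : ℤ) : ℂ) * ((t : ℕ) : ℂ) / ((m * (n + 1) : ℕ) : ℂ))) + ((1 / ((m * n : ℕ) : ℂ)) * ∑ t ∈ Finset.Icc 1 x, ((w t : ℝ) : ℂ) * Complex.exp (2 * Real.pi * Complex.I * ((h : ℤ) : ℂ) * ((t : ℕ) : ℂ) / ((m * n : ℕ) : ℂ)))‖ ≤ 4 * (∑ t ∈ Finset.Icc 1 x, w t) * (1 + 3 * Real.pi * (|(h : ℝ)| * x) / ((a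 : ℝ) * b)) ^ 2 / ((a : ℝ) * b) :=
  @Poisson.variation_G_le

end Summit.Parity.BatemanHorn.Cruxes.SplitBlockJacobi.CofactorRootDiscrepancy

end
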